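import Mathlib
import Literature.MathematicalPhysics.QuantumFieldTheory.Luscher2010.TrivializingMaps
import Literature.MathematicalPhysics.QuantumFieldTheory.Luscher2010.FlowActionSeries
import Summits.Ventures.LatticeQCDFlow.TrivializingMaps.FisherRadiusIdentity
import Summits.Ventures.LatticeQCDFlow.TrivializingMaps.FisherObstruction
import Summits.Ventures.LatticeQCDFlow.TrivializingMaps.LuscherSeriesExistence
import Summits.Ventures.LatticeQCDFlow.TrivializingMaps.GradedTheoremA
import HarnessLib

/-!
HONEST FRAMING: exact (Metropolis-corrected) sampling algorithms for lattice gauge theory; figures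
of merit are autocorrelation/cost numbers at stated couplings and volumes; no continuum-physics
claim.

# FisherRadiusCap — THEOREM F′ (THEORY-1.md §13.1): the geometric radius of a Lüscher series is
capped by the Fisher zeros of the finite-volume partition functions

Proposed tree path: `Summits/Ventures/LatticeQCDFlow/TrivializingMaps/FisherRadiusCap.lean` (OURS —
venture-side, never `Literature/`). Companion of `FisherRadiusIdentity` (THEOREM F, exact form:
`Z′(s) = (∑_{k≤N} Ċ^{(k)} s^k) Z(s) + s^{N+1} J_N(s)` for the Haar moment generating function
`Z(s) = ∫ D[U] e^{-sS}` of a smooth action with a smooth Lüscher series) and of `FisherObstruction`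
(an analytic logarithmic derivative excludes zeros).

## Results

Fix a smooth action `S` on `SU(n)^E` (periodic lattice `(ℤ/L)^d`), a smooth Lüscher series
`(S^{(k)}, Ċ^{(k)})_k` of it, and a GEOMETRIC GRADIENT BOUND `|∂^a_e S^{(k)}| ≤ C ρ^{-k}` (`ρ > 0`;
for the Wilson action this is the conclusion of THEOREM A, `LuscherGeometricGradientBound`, proved
in file `GradedTheoremA`).

* `IsLuscherSeries.abs_const_succ_le`: `|Ċ^{(k+1)}| ≤ (∑_{e,a} ⟨|∂^a_e S|⟩) · C ρ^{-k}` — the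
  constants inherit the geometric bound; `IsLuscherSeries.summable_abs_const_mul_pow`: the
  constants' series `Ċ(s) = ∑_k Ċ^{(k)} s^k` converges absolutely on `|s| < ρ`.
* `IsLuscherSeries.deriv_actionZ_eq_tsum_mul`: **`Z′(s) = Ċ(s) Z(s)` on `|s| < ρ`** (the remainder
  `s^{N+1} J_N(s)` of THEOREM F is `O((|s|/ρ)^N) → 0`).
* **`IsLuscherSeries.actionZ_ne_zero` (THEOREM F′): `Z(s) ≠ 0` for `|s| < ρ`**, by
  `Fisher.ne_zero_of_deriv_eq_mul`; equivalently
  **`IsLuscherSeries.radius_le_norm_of_actionZ_eq_zero`: every complex zero `s₀` of `Z` caps the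
  geometric radius, `ρ ≤ |s₀|`.**
* `IsLuscherSeries.hasSum_const_mul_pow` (THEOREM F, convergent form):
  `∑_k Ċ^{(k)} s^k = Z′(s)/Z(s)` on `|s| < ρ`; real form
  `IsLuscherSeries.hasSum_const_mul_pow_real`: `Ċ_t = -⟨S⟩_{tS}` (minus the mean action of
  the interpolating ensemble `e^{-tS} D[U]/Z(t)`), `|t| < ρ`.
* Wilson action (`S = s · ∑_p Re tr(1 - U_p)`, i.e. `s = β/N` for the conventional
  `β ∑_p (1 - N⁻¹ Re tr U_p)`): `wilson_radius_le_norm_of_actionZ_eq_zero` — ANY pair `(ρ, C)`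
  satisfying THEOREM A's volume-uniform bound has `ρ ≤ |s₀|` for every zero `s₀` of the partition
  function `Z_L(s) = ∫ D[U] e^{-s S_W}` of EVERY volume `L`;
  `wilson_radius_le_norm_of_zeros_accumulate` — hence `ρ ≤ |s_c|` whenever zeros of `(Z_L)_L`
  accumulate at `s_c` (the thermodynamic Fisher / Lee–Yang mechanism, cf. file `WilsonPinching`);
  and, feeding in the PROVED THEOREM A (`GradedSeries.luscherGeometricGradientBound_holds`), the
  unconditional **`wilson_actionZ_zeroFree_uniform`: there is `ρ = ρ(d, n) > 0` with `Z_L(s) ≠ 0`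
  for all `L` and all complex `|s| < ρ`** — a volume-uniform zero-free disc of the `SU(n)` Wilson
  plaquette partition functions around `β = 0`, obtained here from the trivializing-flow series
  rather than from a cluster expansion.

## Method

Elementary estimates (`abs_const_succ_le`, `norm_pairing_le`) turn THEOREM F into the ODE
`Z′ = Ċ Z` on the disc, with `Ċ` continuous (uniform limit of polynomials) and `Z` entire
(`differentiable_actionZ`); `Fisher.ne_zero_of_deriv_eq_mul` (isolated zeros of analytic functions)
then forbids zeros since `Z(0) = 1`. No estimate on `Z` itself is used: the cap is blind to HOW a
geometric gradient bound is proved, which is the point of THEOREM F′ — no method can push the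
geometric radius of Lüscher's series past the first Fisher zero of any finite volume.

References: M. Lüscher, Comm. Math. Phys. 293 (2010) 899–919, §4 [key Luscher2010Trivializing];
M. E. Fisher, in Lectures in Theoretical Physics VII C (1965) (zeros of the partition function);
THEORY-1.md §13.1 (THEOREM F / F′), §19 (THEOREM A).
-/

open MeasureTheory ProbabilityTheory Filter Topology Complex Set Metric
open Literature.MathematicalPhysics.QuantumFieldTheory
open Literature.MathematicalPhysics.QuantumFieldTheory.Luscher2010
open Literature.MathematicalPhysics.QuantumFieldTheory.WilsonFlow (coeConfig continuous_coeConfig)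
open scoped Matrix Matrix.Norms.Frobenius ContDiff

namespace Summit.Ventures.LatticeQCDFlow.TrivializingMaps

variable {d L n : ℕ}

section General

variable [NeZero L] {B : SuBasis n} {S : AmbConfig d L n → ℝ} {Sk : ℕ → AmbConfig d L n → ℝ}
  {c : ℕ → ℝ} {ρ C : ℝ}

/-- **The constants inherit the geometric bound**:
`|Ċ^{(k+1)}| ≤ (∑_{e,a} ⟨|∂^a_e S|⟩_{D[U]}) C ρ^{-k}` (from
`Ċ^{(k+1)} = ∑_{e,a} ⟨∂^a_e S ∂^a_e S^{(k)}⟩`). [cite: Luscher2010Trivializing, §4.3 eq. (4.15)] -/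
theorem IsLuscherSeries.abs_const_succ_le (h : IsLuscherSeries B S Sk c) (hS : ContDiff ℝ ∞ S)
    (hSk : ∀ k, ContDiff ℝ ∞ (Sk k))
    (hC : ∀ (k : ℕ) (U : GaugeConfig d L (Matrix.specialUnitaryGroup (Fin n) ℂ)) (e : Edge d L)
      (a : B.ι), |linkDeriv e (B.T a) (Sk k) (coeConfig U)| ≤ C * ρ⁻¹ ^ k) (k : ℕ) :
    |c (k + 1)| ≤ (∑ e : Edge d L, ∑ a : B.ι, ∫ U, |linkDeriv e (B.T a) S (coeConfig U)|
        ∂(trivialMeasure (Matrix.specialUnitaryGroup (Fin n) ℂ) d L)) * (C * ρ⁻¹ ^ k) := by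
  rw [IsLuscherSeries.const_succ_eq_sum_integral h hS hSk k, Finset.sum_mul]
  refine (Finset.abs_sum_le_sum_abs _ _).trans (Finset.sum_le_sum fun e _ => ?_)
  rw [Finset.sum_mul]
  refine (Finset.abs_sum_le_sum_abs _ _).trans (Finset.sum_le_sum fun a _ => ?_)
  rw [← integral_mul_const]
  have hdS := continuous_comp_coeConfig (contDiff_linkDeriv hS e (B.T a))
  have hdSk := continuous_comp_coeConfig (contDiff_linkDeriv (hSk k) e (B.T a))
  refine abs_integral_le_integral_abs.trans (integral_mono ?_ ?_ fun U => ?_)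
  · exact (integrable_trivialMeasure_of_continuous (hdS.mul hdSk)).abs
  · exact (integrable_trivialMeasure_of_continuous hdS).abs.mul_const _
  · simp only [abs_mul]
    exact mul_le_mul_of_nonneg_left (hC k U e a) (abs_nonneg _)

/-- **The remainder pairing is geometrically small**: `‖J_N(s)‖ =
‖∑_{e,a} ∫ D[U] e^{-sS} ∂^a_e S ∂^a_e S^{(N)}‖ ≤ (∑_{e,a} ∫ D[U] |e^{-sS}| |∂^a_e S|) C ρ^{-N}`.
[folklore] -/
theorem norm_pairing_le (hS : ContDiff ℝ ∞ S) (hSk : ∀ k, ContDiff ℝ ∞ (Sk k))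
    (hC : ∀ (k : ℕ) (U : GaugeConfig d L (Matrix.specialUnitaryGroup (Fin n) ℂ)) (e : Edge d L)
      (a : B.ι), |linkDeriv e (B.T a) (Sk k) (coeConfig U)| ≤ C * ρ⁻¹ ^ k) (s : ℂ) (N : ℕ) :
    ‖∑ e : Edge d L, ∑ a : B.ι, ∫ U, cexp (-(s * (S (coeConfig U) : ℂ))) *
        ((linkDeriv e (B.T a) S (coeConfig U) * linkDeriv e (B.T a) (Sk N) (coeConfig U) : ℝ) : ℂ)
          ∂(trivialMeasure (Matrix.specialUnitaryGroup (Fin n) ℂ) d L)‖ ≤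
      (∑ e : Edge d L, ∑ a : B.ι, ∫ U, ‖cexp (-(s * (S (coeConfig U) : ℂ)))‖ *
          |linkDeriv e (B.T a) S (coeConfig U)|
            ∂(trivialMeasure (Matrix.specialUnitaryGroup (Fin n) ℂ) d L)) * (C * ρ⁻¹ ^ N) := by
  rw [Finset.sum_mul]
  refine (norm_sum_le _ _).trans (Finset.sum_le_sum fun e _ => ?_)
  rw [Finset.sum_mul]
  refine (norm_sum_le _ _).trans (Finset.sum_le_sum fun a _ => ?_)
  rw [← integral_mul_const]
  have hwc : Continuous fun U : GaugeConfig d L (Matrix.specialUnitaryGroup (Fin n) ℂ) =>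
      cexp (-(s * (S (coeConfig U) : ℂ))) :=
    (contDiff_cexp_neg_mul hS s).continuous.comp continuous_coeConfig
  have hdS := continuous_comp_coeConfig (contDiff_linkDeriv hS e (B.T a))
  have hdSk := continuous_comp_coeConfig (contDiff_linkDeriv (hSk N) e (B.T a))
  refine (norm_integral_le_integral_norm _).trans (integral_mono ?_ ?_ fun U => ?_)
  · exact (integrable_trivialMeasure_of_continuous_complex
      (hwc.mul (Complex.continuous_ofReal.comp (hdS.mul hdSk)))).norm
  · exact (integrable_trivialMeasure_of_continuous (hwc.norm.mul hdS.abs)).mul_const _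
  · simp only [norm_mul, Complex.norm_real, Real.norm_eq_abs]
    rw [mul_assoc]
    exact mul_le_mul_of_nonneg_left (mul_le_mul_of_nonneg_left (hC N U e a) (abs_nonneg _))
      (norm_nonneg _)

/-- **The constants' series converges absolutely on `|s| < ρ`**: `∑_k |Ċ^{(k)}| r^k < ∞` for
`0 ≤ r < ρ` (geometric majorant). [folklore] -/
theorem IsLuscherSeries.summable_abs_const_mul_pow (h : IsLuscherSeries B S Sk c)
    (hS : ContDiff ℝ ∞ S) (hSk : ∀ k, ContDiff ℝ ∞ (Sk k)) (hρ : 0 < ρ)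
    (hC : ∀ (k : ℕ) (U : GaugeConfig d L (Matrix.specialUnitaryGroup (Fin n) ℂ)) (e : Edge d L)
      (a : B.ι), |linkDeriv e (B.T a) (Sk k) (coeConfig U)| ≤ C * ρ⁻¹ ^ k)
    {r : ℝ} (hr0 : 0 ≤ r) (hr : r < ρ) : Summable fun k => |c k| * r ^ k := by
  set A := ∑ e : Edge d L, ∑ a : B.ι, ∫ U, |linkDeriv e (B.T a) S (coeConfig U)|
    ∂(trivialMeasure (Matrix.specialUnitaryGroup (Fin n) ℂ) d L) with hA
  have hq0 : 0 ≤ r * ρ⁻¹ := mul_nonneg hr0 (inv_nonneg.mpr hρ.le)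
  have hq1 : r * ρ⁻¹ < 1 := by rw [← div_eq_mul_inv, div_lt_one hρ]; exact hr
  have hgeo : Summable fun k : ℕ => A * C * r * (r * ρ⁻¹) ^ k :=
    (summable_geometric_of_lt_one hq0 hq1).mul_left _
  have hle : ∀ k, |c (k + 1)| * r ^ (k + 1) ≤ A * C * r * (r * ρ⁻¹) ^ k := fun k =>
    calc |c (k + 1)| * r ^ (k + 1) ≤ A * (C * ρ⁻¹ ^ k) * r ^ (k + 1) :=
          mul_le_mul_of_nonneg_right (IsLuscherSeries.abs_const_succ_le h hS hSk hC k)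
            (pow_nonneg hr0 _)
      _ = A * C * r * (r * ρ⁻¹) ^ k := by rw [mul_pow, pow_succ]; ring
  have h1 : Summable fun k => |c (k + 1)| * r ^ (k + 1) :=
    Summable.of_nonneg_of_le (fun k => mul_nonneg (abs_nonneg _) (pow_nonneg hr0 _)) hle hgeo
  exact (summable_nat_add_iff (f := fun k => |c k| * r ^ k) 1).mp h1

/-- Complex form: `∑_k Ċ^{(k)} s^k` converges absolutely for complex `|s| < ρ`. [folklore] -/
theorem IsLuscherSeries.summable_const_mul_pow (h : IsLuscherSeries B S Sk c)
    (hS : ContDiff ℝ ∞ S) (hSk : ∀ k, ContDiff ℝ ∞ (Sk k)) (hρ : 0 < ρ)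
    (hC : ∀ (k : ℕ) (U : GaugeConfig d L (Matrix.specialUnitaryGroup (Fin n) ℂ)) (e : Edge d L)
      (a : B.ι), |linkDeriv e (B.T a) (Sk k) (coeConfig U)| ≤ C * ρ⁻¹ ^ k)
    {s : ℂ} (hs : ‖s‖ < ρ) : Summable fun k => (c k : ℂ) * s ^ k := by
  refine .of_norm ?_
  have h1 := IsLuscherSeries.summable_abs_const_mul_pow h hS hSk hρ hC (norm_nonneg s) hs
  simpa only [norm_mul, Complex.norm_real, Real.norm_eq_abs, norm_pow] using h1

/-- The constants' series is continuous on every disc `|s| < r`, `r < ρ` (uniform limit of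
polynomials). [folklore] -/
theorem IsLuscherSeries.continuousOn_tsum_const_mul_pow (h : IsLuscherSeries B S Sk c)
    (hS : ContDiff ℝ ∞ S) (hSk : ∀ k, ContDiff ℝ ∞ (Sk k)) (hρ : 0 < ρ)
    (hC : ∀ (k : ℕ) (U : GaugeConfig d L (Matrix.specialUnitaryGroup (Fin n) ℂ)) (e : Edge d L)
      (a : B.ι), |linkDeriv e (B.T a) (Sk k) (coeConfig U)| ≤ C * ρ⁻¹ ^ k)
    {r : ℝ} (hr : r < ρ) :
    ContinuousOn (fun s : ℂ => ∑' k, (c k : ℂ) * s ^ k) (ball (0 : ℂ) r) := by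
  rcases le_or_gt r 0 with hr0 | hr0
  · rw [Metric.ball_eq_empty.mpr hr0]
    exact continuousOn_empty _
  refine continuousOn_tsum (u := fun k => |c k| * r ^ k)
    (fun k => (continuous_const.mul (continuous_pow k)).continuousOn)
    (IsLuscherSeries.summable_abs_const_mul_pow h hS hSk hρ hC hr0.le hr) fun k s hs => ?_
  rw [norm_mul, Complex.norm_real, Real.norm_eq_abs, norm_pow]
  exact mul_le_mul_of_nonneg_left
    (pow_le_pow_left₀ (norm_nonneg _) (mem_ball_zero_iff.mp hs).le k) (abs_nonneg _)

/-- **`Z′(s) = Ċ(s) Z(s)` on the disc `|s| < ρ`**: the remainder `s^{N+1} J_N(s)` of THEOREM F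
(`IsLuscherSeries.deriv_complexMGF_eq`) is `O(|s| (|s|/ρ)^N) → 0`.
[cite: Luscher2010Trivializing, §4.2 eq. (4.9)] -/
theorem IsLuscherSeries.deriv_actionZ_eq_tsum_mul (h : IsLuscherSeries B S Sk c)
    (hS : ContDiff ℝ ∞ S) (hSk : ∀ k, ContDiff ℝ ∞ (Sk k)) (hρ : 0 < ρ)
    (hC : ∀ (k : ℕ) (U : GaugeConfig d L (Matrix.specialUnitaryGroup (Fin n) ℂ)) (e : Edge d L)
      (a : B.ι), |linkDeriv e (B.T a) (Sk k) (coeConfig U)| ≤ C * ρ⁻¹ ^ k)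
    {s : ℂ} (hs : ‖s‖ < ρ) :
    deriv (complexMGF (fun U => -S (coeConfig U))
        (trivialMeasure (Matrix.specialUnitaryGroup (Fin n) ℂ) d L)) s =
      (∑' k, (c k : ℂ) * s ^ k) * complexMGF (fun U => -S (coeConfig U))
        (trivialMeasure (Matrix.specialUnitaryGroup (Fin n) ℂ) d L) s := by
  -- the remainder pairings `J_N(s)`
  obtain ⟨J, hJ⟩ : ∃ J : ℕ → ℂ, ∀ N, J N = ∑ e : Edge d L, ∑ a : B.ι, ∫ U,
      cexp (-(s * (S (coeConfig U) : ℂ))) *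
        ((linkDeriv e (B.T a) S (coeConfig U) * linkDeriv e (B.T a) (Sk N) (coeConfig U) : ℝ) : ℂ)
          ∂(trivialMeasure (Matrix.specialUnitaryGroup (Fin n) ℂ) d L) := ⟨_, fun _ => rfl⟩
  -- (1) partial sums of the constants' series converge
  have h1 : Tendsto (fun N => ∑ k ∈ Finset.range (N + 1), (c k : ℂ) * s ^ k) atTop
      (𝓝 (∑' k, (c k : ℂ) * s ^ k)) :=
    (IsLuscherSeries.summable_const_mul_pow h hS hSk hρ hC hs).hasSum.tendsto_sum_nat.comp
      (tendsto_add_atTop_nat 1)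
  -- (2) the remainder tends to zero geometrically
  obtain ⟨A, hA⟩ : ∃ A : ℝ, ∀ N, ‖J N‖ ≤ A * (C * ρ⁻¹ ^ N) :=
    ⟨_, fun N => by rw [hJ]; exact norm_pairing_le hS hSk hC s N⟩
  have hq0 : 0 ≤ ‖s‖ * ρ⁻¹ := mul_nonneg (norm_nonneg _) (inv_nonneg.mpr hρ.le)
  have hq1 : ‖s‖ * ρ⁻¹ < 1 := by rw [← div_eq_mul_inv, div_lt_one hρ]; exact hs
  have h0 := (tendsto_pow_atTop_nhds_zero_of_lt_one hq0 hq1).const_mul (‖s‖ * A * C)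
  rw [mul_zero] at h0
  have h2 : Tendsto (fun N => s ^ (N + 1) * J N) atTop (𝓝 0) := by
    refine squeeze_zero_norm (fun N => ?_) h0
    rw [norm_mul, norm_pow]
    calc ‖s‖ ^ (N + 1) * ‖J N‖ ≤ ‖s‖ ^ (N + 1) * (A * (C * ρ⁻¹ ^ N)) :=
          mul_le_mul_of_nonneg_left (hA N) (pow_nonneg (norm_nonneg _) _)
      _ = ‖s‖ * A * C * (‖s‖ * ρ⁻¹) ^ N := by rw [mul_pow, pow_succ]; ring
  -- (3) THEOREM F says the sum of the two is constantly `Z′(s)`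
  have h3 := (h1.mul_const (complexMGF (fun U => -S (coeConfig U))
    (trivialMeasure (Matrix.specialUnitaryGroup (Fin n) ℂ) d L) s)).add h2
  rw [add_zero] at h3
  have h4 : ∀ N, (∑ k ∈ Finset.range (N + 1), (c k : ℂ) * s ^ k) *
      complexMGF (fun U => -S (coeConfig U))
        (trivialMeasure (Matrix.specialUnitaryGroup (Fin n) ℂ) d L) s + s ^ (N + 1) * J N =
      deriv (complexMGF (fun U => -S (coeConfig U))
        (trivialMeasure (Matrix.specialUnitaryGroup (Fin n) ℂ) d L)) s := fun N => by
    rw [hJ]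
    exact (IsLuscherSeries.deriv_complexMGF_eq h hS hSk N s).symm
  simp_rw [h4] at h3
  exact tendsto_const_nhds_iff.mp h3

/-- **THEOREM F′ (zero-free disc).** A smooth action with a smooth Lüscher series obeying a
geometric gradient bound of ratio `ρ⁻¹` has `Z(s) = ∫ D[U] e^{-sS} ≠ 0` for all complex `|s| < ρ`
(`Z′ = Ċ Z` with `Ċ` continuous, `Z` analytic, `Z(0) = 1`: `Fisher.ne_zero_of_deriv_eq_mul`).
[cite: Luscher2010Trivializing, §4.5(b)] -/
theorem IsLuscherSeries.actionZ_ne_zero (h : IsLuscherSeries B S Sk c)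
    (hS : ContDiff ℝ ∞ S) (hSk : ∀ k, ContDiff ℝ ∞ (Sk k)) (hρ : 0 < ρ)
    (hC : ∀ (k : ℕ) (U : GaugeConfig d L (Matrix.specialUnitaryGroup (Fin n) ℂ)) (e : Edge d L)
      (a : B.ι), |linkDeriv e (B.T a) (Sk k) (coeConfig U)| ≤ C * ρ⁻¹ ^ k)
    {s : ℂ} (hs : ‖s‖ < ρ) :
    complexMGF (fun U => -S (coeConfig U))
      (trivialMeasure (Matrix.specialUnitaryGroup (Fin n) ℂ) d L) s ≠ 0 := by
  obtain ⟨r, hsr, hrρ⟩ := exists_between hs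
  have hr0 : 0 < r := (norm_nonneg s).trans_lt hsr
  refine Fisher.ne_zero_of_deriv_eq_mul Metric.isOpen_ball (convex_ball (0 : ℂ) r).isPreconnected
    (differentiable_actionZ hS).differentiableOn
    (IsLuscherSeries.continuousOn_tsum_const_mul_pow h hS hSk hρ hC hrρ)
    (fun z hz => IsLuscherSeries.deriv_actionZ_eq_tsum_mul h hS hSk hρ hC
      ((mem_ball_zero_iff.mp hz).trans hrρ))
    (mem_ball_self hr0) ?_ s (mem_ball_zero_iff.mpr hsr)
  rw [complexMGF_neg_action_eq]
  simp

/-- **THEOREM F′ (the cap).** Every complex zero `s₀` of `Z(s) = ∫ D[U] e^{-sS}` caps the geometric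
radius of any smooth Lüscher series of `S`: if `|∂^a_e S^{(k)}| ≤ C ρ^{-k}` for all `k`, then
`ρ ≤ |s₀|`. [cite: Luscher2010Trivializing, §4.5(b)] -/
theorem IsLuscherSeries.radius_le_norm_of_actionZ_eq_zero (h : IsLuscherSeries B S Sk c)
    (hS : ContDiff ℝ ∞ S) (hSk : ∀ k, ContDiff ℝ ∞ (Sk k)) (hρ : 0 < ρ)
    (hC : ∀ (k : ℕ) (U : GaugeConfig d L (Matrix.specialUnitaryGroup (Fin n) ℂ)) (e : Edge d L)
      (a : B.ι), |linkDeriv e (B.T a) (Sk k) (coeConfig U)| ≤ C * ρ⁻¹ ^ k)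
    {s₀ : ℂ} (hz : complexMGF (fun U => -S (coeConfig U))
      (trivialMeasure (Matrix.specialUnitaryGroup (Fin n) ℂ) d L) s₀ = 0) : ρ ≤ ‖s₀‖ :=
  not_lt.mp fun hs => IsLuscherSeries.actionZ_ne_zero h hS hSk hρ hC hs hz

/-- **THEOREM F (convergent form).** On `|s| < ρ` the constants' series sums to the logarithmic
derivative of the partition function: `∑_k Ċ^{(k)} s^k = Z′(s)/Z(s)`.
[cite: Luscher2010Trivializing, §4.2 eq. (4.9)] -/
theorem IsLuscherSeries.hasSum_const_mul_pow (h : IsLuscherSeries B S Sk c)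
    (hS : ContDiff ℝ ∞ S) (hSk : ∀ k, ContDiff ℝ ∞ (Sk k)) (hρ : 0 < ρ)
    (hC : ∀ (k : ℕ) (U : GaugeConfig d L (Matrix.specialUnitaryGroup (Fin n) ℂ)) (e : Edge d L)
      (a : B.ι), |linkDeriv e (B.T a) (Sk k) (coeConfig U)| ≤ C * ρ⁻¹ ^ k)
    {s : ℂ} (hs : ‖s‖ < ρ) :
    HasSum (fun k => (c k : ℂ) * s ^ k)
      (deriv (complexMGF (fun U => -S (coeConfig U))
          (trivialMeasure (Matrix.specialUnitaryGroup (Fin n) ℂ) d L)) s /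
        complexMGF (fun U => -S (coeConfig U))
          (trivialMeasure (Matrix.specialUnitaryGroup (Fin n) ℂ) d L) s) := by
  rw [IsLuscherSeries.deriv_actionZ_eq_tsum_mul h hS hSk hρ hC hs,
    mul_div_cancel_right₀ _ (IsLuscherSeries.actionZ_ne_zero h hS hSk hρ hC hs)]
  exact (IsLuscherSeries.summable_const_mul_pow h hS hSk hρ hC hs).hasSum

/-- **THEOREM F (real form): `Ċ_t = -⟨S⟩_{tS}`** — for real `|t| < ρ` the flow constant
`Ċ_t = ∑_k Ċ^{(k)} t^k` is minus the mean action of the interpolating ensemble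
`e^{-tS} D[U] / Z(t)`.
[cite: Luscher2010Trivializing, §4.2 eq. (4.9)] -/
theorem IsLuscherSeries.hasSum_const_mul_pow_real (h : IsLuscherSeries B S Sk c)
    (hS : ContDiff ℝ ∞ S) (hSk : ∀ k, ContDiff ℝ ∞ (Sk k)) (hρ : 0 < ρ)
    (hC : ∀ (k : ℕ) (U : GaugeConfig d L (Matrix.specialUnitaryGroup (Fin n) ℂ)) (e : Edge d L)
      (a : B.ι), |linkDeriv e (B.T a) (Sk k) (coeConfig U)| ≤ C * ρ⁻¹ ^ k)
    {t : ℝ} (ht : |t| < ρ) :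
    HasSum (fun k => c k * t ^ k)
      (-(∫ U, Real.exp (-(t * S (coeConfig U))) * S (coeConfig U)
          ∂(trivialMeasure (Matrix.specialUnitaryGroup (Fin n) ℂ) d L)) /
        ∫ U, Real.exp (-(t * S (coeConfig U)))
          ∂(trivialMeasure (Matrix.specialUnitaryGroup (Fin n) ℂ) d L)) := by
  have hs : ‖(t : ℂ)‖ < ρ := by rwa [Complex.norm_real, Real.norm_eq_abs]
  have hc := IsLuscherSeries.hasSum_const_mul_pow h hS hSk hρ hC hs
  rw [deriv_actionZ_eq hS, complexMGF_neg_action_eq] at hc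
  have h1 : ∫ U, cexp (-((t : ℂ) * (S (coeConfig U) : ℂ))) * (S (coeConfig U) : ℂ)
      ∂(trivialMeasure (Matrix.specialUnitaryGroup (Fin n) ℂ) d L) =
      ((∫ U, Real.exp (-(t * S (coeConfig U))) * S (coeConfig U)
        ∂(trivialMeasure (Matrix.specialUnitaryGroup (Fin n) ℂ) d L) : ℝ) : ℂ) := by
    rw [← integral_complex_ofReal]
    push_cast
    rfl
  have h2 : ∫ U, cexp (-((t : ℂ) * (S (coeConfig U) : ℂ)))
      ∂(trivialMeasure (Matrix.specialUnitaryGroup (Fin n) ℂ) d L) =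
      ((∫ U, Real.exp (-(t * S (coeConfig U)))
        ∂(trivialMeasure (Matrix.specialUnitaryGroup (Fin n) ℂ) d L) : ℝ) : ℂ) := by
    rw [← integral_complex_ofReal]
    push_cast
    rfl
  rw [h1, h2] at hc
  exact_mod_cast hc

end General

/-! ## The Wilson action: THEOREM A's radius versus the Fisher zeros of every volume -/

section Wilson

/-- **COROLLARY F′ (Wilson action).** Any pair `(ρ, C)` satisfying THEOREM A's volume-uniform
geometric gradient bound for the Lüscher series of the `SU(n)` Wilson plaquette action (the body of
`LuscherGeometricGradientBound d n`) has `ρ ≤ |s₀|` for every complex zero `s₀` of the partition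
function `Z_L(s) = ∫ D[U] e^{-s S_W}` of EVERY periodic volume `L` (`S_W = ∑_p Re tr(1 - U_p)`;
`s = β/N` in the conventional normalisation). [cite: Luscher2010Trivializing, §4.5(b)] -/
theorem wilson_radius_le_norm_of_actionZ_eq_zero {ρ C : ℝ} (hρ : 0 < ρ)
    (hA : ∀ (L : ℕ) [NeZero L] (B : SuBasis n) (Sk : ℕ → AmbConfig d L n → ℝ) (c : ℕ → ℝ),
      (∀ k, ContDiff ℝ ∞ (Sk k)) → IsLuscherSeries B ambWilsonAction Sk c →
      ∀ (k : ℕ) (U : GaugeConfig d L (Matrix.specialUnitaryGroup (Fin n) ℂ)) (e : Edge d L)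
        (a : B.ι), |linkDeriv e (B.T a) (Sk k) (coeConfig U)| ≤ C * ρ⁻¹ ^ k)
    (B : SuBasis n) (L : ℕ) [NeZero L] {s₀ : ℂ}
    (hz : complexMGF (fun U => -ambWilsonAction (coeConfig U))
      (trivialMeasure (Matrix.specialUnitaryGroup (Fin n) ℂ) d L) s₀ = 0) : ρ ≤ ‖s₀‖ :=
  IsLuscherSeries.radius_le_norm_of_actionZ_eq_zero (isLuscherSeries_wilsonSk B)
    contDiff_ambWilsonAction (contDiff_wilsonSk B) hρ
    (hA L B _ _ (contDiff_wilsonSk B) (isLuscherSeries_wilsonSk B)) hz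

/-- **COROLLARY F′ (accumulating zeros).** If complex zeros of the finite-volume Wilson partition
functions `(Z_L)_L` accumulate at `s_c` (the Fisher / Lee–Yang mechanism of a thermodynamic
singularity, cf. file `WilsonPinching`), then every radius `ρ` of a THEOREM-A-type geometric
gradient bound obeys `ρ ≤ |s_c|`. [cite: Luscher2010Trivializing, §4.5(b)] -/
theorem wilson_radius_le_norm_of_zeros_accumulate {ρ C : ℝ} (hρ : 0 < ρ)
    (hA : ∀ (L : ℕ) [NeZero L] (B : SuBasis n) (Sk : ℕ → AmbConfig d L n → ℝ) (c : ℕ → ℝ),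
      (∀ k, ContDiff ℝ ∞ (Sk k)) → IsLuscherSeries B ambWilsonAction Sk c →
      ∀ (k : ℕ) (U : GaugeConfig d L (Matrix.specialUnitaryGroup (Fin n) ℂ)) (e : Edge d L)
        (a : B.ι), |linkDeriv e (B.T a) (Sk k) (coeConfig U)| ≤ C * ρ⁻¹ ^ k)
    (B : SuBasis n) {sc : ℂ}
    (hacc : ∀ r > 0, ∃ (L : ℕ) (_ : NeZero L) (s₀ : ℂ), ‖s₀ - sc‖ < r ∧
      complexMGF (fun U => -ambWilsonAction (coeConfig U))
        (trivialMeasure (Matrix.specialUnitaryGroup (Fin n) ℂ) d L) s₀ = 0) : ρ ≤ ‖sc‖ := by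
  refine not_lt.mp fun hlt => ?_
  obtain ⟨L, hL, s₀, hs₀, hz⟩ := hacc (ρ - ‖sc‖) (sub_pos.mpr hlt)
  have hcap := wilson_radius_le_norm_of_actionZ_eq_zero hρ hA B L hz
  have htri : ‖s₀‖ ≤ ‖s₀ - sc‖ + ‖sc‖ := by
    calc ‖s₀‖ = ‖(s₀ - sc) + sc‖ := by rw [sub_add_cancel]
      _ ≤ ‖s₀ - sc‖ + ‖sc‖ := norm_add_le _ _
  linarith

/-- **A volume-uniform zero-free disc of the `SU(n)` Wilson partition functions (unconditional).**
Feeding the PROVED THEOREM A (`GradedSeries.luscherGeometricGradientBound_holds`) into THEOREM F′: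
for every `d, n` (given an orthonormal basis of `𝔰𝔲(n)`, used only to run Lüscher's recursion)
there is `ρ > 0` such that `Z_L(s) = ∫ D[U] e^{-s S_W} ≠ 0` for EVERY periodic volume `L` and every
complex `|s| < ρ`. [ours; cf. Luscher2010Trivializing §4.5(b)] -/
theorem wilson_actionZ_zeroFree_uniform (d n : ℕ) (B : SuBasis n) :
    ∃ ρ : ℝ, 0 < ρ ∧ ∀ (L : ℕ) [NeZero L] (s : ℂ), ‖s‖ < ρ →
      complexMGF (fun U => -ambWilsonAction (coeConfig U))
        (trivialMeasure (Matrix.specialUnitaryGroup (Fin n) ℂ) d L) s ≠ 0 := by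
  obtain ⟨ρ, hρ, C, hA⟩ := GradedSeries.luscherGeometricGradientBound_holds d n
  exact ⟨ρ, hρ, fun L _ s hs hz =>
    absurd (wilson_radius_le_norm_of_actionZ_eq_zero hρ hA B L hz) (not_le.mpr hs)⟩

end Wilson

end Summit.Ventures.LatticeQCDFlow.TrivializingMaps
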